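import Summits.AtomisticToContinuum.FouriersLaw.Theses.CageBudgetFekete

/-!
# Line `spectral-germ` — crux `QuasiSuperadditiveHeatVariance` (stmt-AtomisticToContinuum-15769), route CageBudgetFekete

Strategist `--alt` line (planner-cstrat-stmt-AtomisticToContinuum-15769-b1-0, 2026-08-17), registered beside
`Lines/birth.lean` and `Lines/ratio_floor.lean`.

Crux (route decl `Summit.AtomisticToContinuum.FouriersLaw.Theses.CageBudgetFekete.QuasiSuperadditiveHeatVariance`):
`∃ K ≥ 0, ∀ s t ≥ 0, V s + V t ≤ V (s+t) + K` for the heat variance `V(τ) = 2∫_{(0,τ]} (τ−s) C_T(s) ds` of every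
guarded pair of `pinnedChain ω₂ lam β γ` (`ω₂, lam, β > 0`, `T > 0`, `C_T = D.currentCorrelation μ` absolutely
convergent and continuous).

## The line (three stubs): BOCHNER LOW-PASS REDUCTION — Q IS A STATEMENT ABOUT THE ZERO-FREQUENCY GERM OF THE
## CURRENT SPECTRAL MEASURE, AND AN L¹-DINI-REGULAR GERM (DRUDE ATOM ALLOWED) IS A CAGE BUDGET

Lever.  `C_T` is continuous, even and positive semi-definite (Koopman isometries of the `μ`-preserving flow, shift
invariance/covariance and absolute convergence of the correlation sum: `Σᵢⱼ cᵢcⱼ C_T(τⱼ−τᵢ) = Σ_x ⟨F, F∘shift^x⟩ ≥ 0`,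
`F = Σ cᵢ j₀∘φ_{τᵢ}`, a Fejér limit of squares), hence (Bochner, landed in tree as
`Summit…Theorems.MourreDissolution.stub_cosineBochner`) `C_T(t) = ∫ cos(ωt) dρ(ω)` for a finite positive measure `ρ`,
the CURRENT SPECTRAL MEASURE.  Then (Fubini)
`V(τ) = ∫ v_τ dρ`, `v_τ(ω) = 2(1 − cos ωτ)/ω²` (`= τ²` at `ω = 0`), `0 ≤ v_τ ≤ min(τ², 4/ω²)`, and the defect is
`D(s,t) := V(s)+V(t)−V(s+t) = ∫ k_{s,t} dρ`, `k_{s,t} = v_s + v_t − v_{s+t} = −8 cos(ω(s+t)/2) sin(ωs/2) sin(ωt/2)/ω²`.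
Three exact facts organise everything:
 (i) `|k_{s,t}(ω)| ≤ 12/ω²`: frequencies `|ω| ≥ ε` contribute at most `12 C_T(0)/ε²` to `D`, uniformly in `s, t` —
     HIGH FREQUENCIES ARE IRRELEVANT, Q depends only on the germ of `ρ` at `ω = 0` (persistent or slowly-decaying
     oscillations of `C_T`, which kill the time-domain stubs of `birth` and `ratio-floor`, are harmless here);
 (ii) `k_{s,t}(0) = s² + t² − (s+t)² = −2st ≤ 0`: a DRUDE ATOM at `0` (ballistic component, the harmonic member) only
     helps — it is allowed, so this line does NOT secretly prove the ceiling crux #3;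
 (iii) `∫_ℝ v_τ(ω) dω = A·τ` (`A = ∫ 2(1−cos u)/u² du = 2π`, by scaling), so `∫_ℝ k_{s,t} dω = 0`: a FLAT germ (white
     current noise, `V = Lτ` exactly) has zero defect, and for a density `f = c + h` on `(−ε, ε)` one gets
     `∫_{(−ε,ε)} k f dω = ∫ k h − c∫_{|ω|≥ε} k dω ≤ 12∫_{(−ε,ε)} |h|/ω² dω + 24c/ε`.
Hence: if near DC `ρ = Δδ₀ + f(ω)dω` with `∫_{(−ε,ε)} |f(ω) − c|/ω² dω < ∞` for some constant `c` (an L¹-DINI-REGULAR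
density at the DC level `c = f(0⁺)`, e.g. `f ∈ C^{1,α}` near `0`, `f` even), then
`D ≤ 12 C_T(0)/ε² + 12∫|f−c|/ω² + 24c/ε =: K`.  WHAT KILLS Q is thereby named precisely: an UPWARD DC CUSP
`f(0) + c′|ω|^θ`, `θ ≤ 1` (time domain: a negative tail `−t^{−1−θ}`; `θ = 1` is the landed negative lemma's
`log`-divergent witness), or a lacunary/singular DC germ.

* `stub_spectralMeasure` — BOCHNER REPRESENTATION OF `C_T` IN THE ARENA (provable now from tree material, L-sized:
  positive semi-definiteness of `C_T` from `PreservesMeasure` + `flow_add` on the co-null carrier + shift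
  invariance + the a.e. shift covariance iterated along `ℤ` + `HasAbsConvergentCorrelation` (Cesàro/Fejér positivity of
  an absolutely summable positive-definite sequence on `ℤ`), evenness from momentum reversal or from the same Fejér
  form, continuity is a hypothesis of the crux; then `MourreDissolution.stub_cosineBochner`).
* `stub_germBoundSuperadditive` — THE GERM BOUND (pure harmonic analysis on a finite measure, provable now, L-sized:
  Fubini for `V = ∫ v_τ dρ`, the bounds (i)–(iii), integrability of `(1−cos u)/u²`).
* `stub_dcGerm` — THE PHYSICAL BET: in the arena, the (unique) SYMMETRIC spectral measure of `C_T` has, on some window `(−ε, ε)`, the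
  form `Δδ₀ + f dω` with `f ≥ 0` measurable and `∫_{(−ε,ε)} |f − c|/ω² < ∞` for some `c ≥ 0`.  Expected with room
  (`Δ = 0`, `f` smooth at DC for the chaotic chain at `T > 0`; `c = T²κ/π`).  Why it might fail: (a) an upward DC cusp /
  negative algebraic tail of the summed-current memory (kills Q too — the route's recorded kill); (b) a DOWNWARD cusp
  `f(0) − c′|ω|^θ`, `θ ≤ 1`, i.e. a POSITIVE heavy tail `+t^{−1−θ}` (slow breather relaxation with a broad rate
  spectrum in the hot anticontinuum window, DeRoeckHuveneers2015) — harmless for Q (lines `birth`/`ratio-floor` cover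
  it) but fatal for this two-sided stub; (c) purely singular continuous DC spectrum.  This is the form in which
  commutator / limiting-absorption methods OUTPUT results (a LAP for the Liouvillian at threshold `0` on Doyon's `ℋ₀`
  with `C²(𝒜)` regularity gives a `C^{1,α}` density; cf. sibling route EmbeddedDrudeMourre, which posits continuity
  of the density at low `T` only) — the strengthen-lens entry of the strategy census, typed.

Assembly (sorry-free): `stub_spectralMeasure` gives `ρ`; `stub_dcGerm` gives `(ε, Δ, c, f)` for that `ρ`;
`stub_germBoundSuperadditive` gives `K`.  `QuasiSuperadditiveHeatVariance_of : Registered.stub_spectralMeasure →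
Registered.stub_germBoundSuperadditive → Registered.stub_dcGerm → CageBudgetFekete.QuasiSuperadditiveHeatVariance`
concludes the crux BY NAME; `QuasiSuperadditiveHeatVariance_of_stubs` instantiates it.

Costume / shred check: S1 and S2 are theorems (Bochner; harmonic analysis) that do not mention the uniform budget for
`C_T`; S2 holds for EVERY finite measure with such a germ and is false without the germ hypothesis (flat-plus-`|ω|`
density: `D ∼ 2c′ log(st/(s+t))`); S3 says nothing about `V`, is not implied by the crux (a positive heavy tail: Q
true, S3 false) nor by the Green–Kubo shell (the negative lemma's witness has an upward `|ω|` cusp at DC: S3 false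
there, as it must be); no stub mentions steady states or `FouriersLaw`.  Three stubs, none bookkeeping.

Disproof used: no `Disproof.lean` exists for this crux.  Landed negative lemma honoured:
`Theorems/QuasiSuperadditiveHeatVariance/Negative/GreenKuboShellInsufficient.lean`
(`quasiSuperadditiveHeatVariance_false_without_dynamics`): the line uses more than the Green–Kubo shell exactly at
`stub_dcGerm` (its witness `C = 4(1+|t|)⁻³ − (1+|t|)⁻²` has spectral density `f(0) + π|ω| + O(ω²)` near DC, for which
`∫|f − c|/ω² = ∞` for every `c`).  `ledger negatives --problem AtomisticToContinuum` (21 entries): none concerns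
closed-chain current autocorrelations or their spectral measures.
-/

namespace Summit.AtomisticToContinuum.FouriersLaw.Cruxes.QuasiSuperadditiveHeatVariance.SpectralGerm

open MeasureTheory Set Filter Topology
open Literature.MathematicalPhysics.KineticTheory.HeatConduction

/-- STUB S1 — BOCHNER REPRESENTATION OF THE SUMMED CURRENT AUTOCORRELATION IN THE ARENA.  For
`pinnedChain ω₂ lam β γ` (`ω₂, lam, β > 0`), `T > 0`, a shift- and momentum-reversal-invariant Gibbs state `μ`, a
`μ`-preserving a.e. shift-covariant infinite-volume dynamics `D` with absolutely convergent correlation sums at every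
time and continuous `C_T = D.currentCorrelation μ`: there is a finite positive SYMMETRIC (`ω ↦ −ω` invariant) Borel
measure `ρ` on `ℝ` (the CURRENT SPECTRAL MEASURE; symmetric representatives are unique, asymmetric ones are not, which
is why symmetry is carried) with `C_T(t) = ∫ cos(ωt) dρ(ω)` for all `t`.  Proof sketch: `C_T` is positive semi-definite over real
coefficient vectors (`Σᵢⱼ cᵢcⱼ C_T(τⱼ−τᵢ) = Σ_x ∫ F·(F∘shift^x) dμ ≥ 0` with `F = Σᵢ cᵢ j₀∘φ_{τᵢ} ∈ L²(μ)`, by measure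
preservation, the group law on the co-null carrier, shift invariance/covariance and absolute summability — a Fejér
limit of `n⁻¹‖Σ_{x<n} F∘shift^x‖²`), even by the same computation, continuous by hypothesis; conclude with the landed
cosine-Bochner theorem `Summit.AtomisticToContinuum.FouriersLaw.Theorems.MourreDissolution.stub_cosineBochner`, and
symmetrise (`ρ ↦ (ρ + ρ̌)/2` leaves the cosine transform unchanged; or: a real characteristic function is that of a
symmetric law, `Measure.ext_of_charFun`).
[cite: Helfand1960; BonettoLebowitzReyBellet2000 §7 (37); Doyon2022 Lemma 4.5] -/
theorem stub_spectralMeasure :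
    ∀ ω₂ lam β γ : ℝ, 0 < ω₂ → 0 < lam → 0 < β → ∀ T : ℝ, 0 < T →
    ∀ μ : Measure ChainConfig, (pinnedChain ω₂ lam β γ).IsChainGibbsMeasure T μ →
      IsShiftInvariant μ →
      μ.map (fun σ : ChainConfig => fun x : ℤ => ((σ x).1, -(σ x).2)) = μ →
    ∀ D : InfiniteChainDynamics (pinnedChain ω₂ lam β γ), D.PreservesMeasure μ →
      (∀ t : ℝ, ∀ᵐ σ ∂μ, D.flow t (shift σ) = shift (D.flow t σ)) →
      (∀ t : ℝ, D.HasAbsConvergentCorrelation μ t) →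
      Continuous (fun t : ℝ => D.currentCorrelation μ t) →
    ∃ ρ : Measure ℝ, IsFiniteMeasure ρ ∧ ρ.map (fun ω : ℝ => -ω) = ρ ∧
      ∀ t : ℝ, D.currentCorrelation μ t = ∫ ω, Real.cos (ω * t) ∂ρ := by
  sorry

/-- STUB S2 — THE GERM BOUND (pure harmonic analysis).  Let `ρ` be a finite measure on `ℝ`, `C(t) = ∫cos(ωt) dρ(ω)`
and `V(τ) = 2∫_{(0,τ]} (τ−s) C(s) ds`.  If on some window `(−ε, ε)` one has `ρ = Δδ₀ + f dω` with `Δ, c ≥ 0`,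
`f ≥ 0` measurable and `∫_{(−ε,ε)} |f(ω) − c|/ω² dω < ∞`, then `∃ K ≥ 0, ∀ s t ≥ 0, V s + V t ≤ V (s+t) + K`
(explicitly `K = 12ρ(ℝ)/ε² + 12∫_{(−ε,ε)}|f−c|/ω² + 24c/ε`).  Proof sketch: Fubini gives `V(τ) = ∫ v_τ dρ` with
`v_τ(ω) = 2(1−cos ωτ)/ω²` (`τ²` at `0`), `0 ≤ v_τ ≤ min(τ², 4/ω²)`; the defect kernel `k = v_s + v_t − v_{s+t}`
has `|k| ≤ 12/ω²`, `k(0) = −2st ≤ 0`, and `∫_ℝ k dω = 0` (`∫_ℝ v_τ dω = Aτ` by the substitution `u = ωτ`); split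
`ρ` into `|ω| ≥ ε` (bounded by `12ρ(ℝ)/ε²`), the atom (non-positive) and the density `f = c + (f − c)` on the window
(`≤ 12∫|f−c|/ω²` plus `|c∫_{(−ε,ε)} k dω| = |c∫_{|ω|≥ε} k dω| ≤ 24c/ε`). [cite: Helfand1960; Gaspard2022 §3.2.9 (3.116)–(3.117)] -/
theorem stub_germBoundSuperadditive :
    ∀ ρ : Measure ℝ, IsFiniteMeasure ρ →
    ∀ C : ℝ → ℝ, (∀ t : ℝ, C t = ∫ ω, Real.cos (ω * t) ∂ρ) →
    ∀ V : ℝ → ℝ, V = (fun τ : ℝ => 2 * ∫ s in Set.Ioc (0:ℝ) τ, (τ - s) * C s) →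
    ∀ ε Δ c : ℝ, 0 < ε → 0 ≤ Δ → 0 ≤ c →
    ∀ f : ℝ → ℝ, Measurable f → (∀ ω : ℝ, 0 ≤ f ω) →
      IntegrableOn (fun ω : ℝ => |f ω - c| / ω ^ 2) (Set.Ioo (-ε) ε) →
      ρ.restrict (Set.Ioo (-ε) ε) =
        ENNReal.ofReal Δ • Measure.dirac (0:ℝ) +
          (volume.restrict (Set.Ioo (-ε) ε)).withDensity (fun ω : ℝ => ENNReal.ofReal (f ω)) →
    ∃ K : ℝ, 0 ≤ K ∧ ∀ s t : ℝ, 0 ≤ s → 0 ≤ t → V s + V t ≤ V (s + t) + K := by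
  sorry

/-- STUB S3 — THE DC GERM OF THE CURRENT SPECTRAL MEASURE (the physical bet; strengthen-lens form of the crux).
In the crux's arena, every finite SYMMETRIC measure `ρ` representing `C_T` (`C_T(t) = ∫cos(ωt) dρ`; such a `ρ` is
unique — without symmetry the one-sided representative `ρ({0})δ₀ + 2ρ|_{(0,∞)}` would violate any DC-level condition
with `c > 0`) has, on some window
`(−ε, ε)`, the form `Δδ₀ + f dω` — a Drude atom `Δ ≥ 0` (allowed; expected `0`) plus a non-negative measurable
density `f` which is L¹-Dini-regular at its DC level: `∫_{(−ε,ε)} |f(ω) − c|/ω² dω < ∞` for some constant `c ≥ 0`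
(e.g. `f` even and `C^{1,α}` at `0`, `c = f(0) = T²κ/π`).  Fails iff the DC germ carries an upward cusp
`f(0)+c′|ω|^θ`, `θ ≤ 1` (negative memory tail `−t^{−1−θ}`: kills the crux as well), a downward cusp with `θ ≤ 1`
(positive heavy tail: harmless for the crux, fatal here), or singular continuous spectrum at DC.  The output
format of a limiting-absorption principle at threshold `0` for the infinite-volume Liouvillian with second-order
commutator regularity; no such estimate is known for the anharmonic chain at fixed coupling.
[cite: AokiLukkarinenSpohn2006 (3.25)–(3.28); LukkarinenSpohn2008 Prop 2.4; DeRoeckHuveneers2015 Thm 1;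
BonettoLebowitzReyBellet2000 §7; doi:10.1007/s002200000233] -/
theorem stub_dcGerm :
    ∀ ω₂ lam β γ : ℝ, 0 < ω₂ → 0 < lam → 0 < β → ∀ T : ℝ, 0 < T →
    ∀ μ : Measure ChainConfig, (pinnedChain ω₂ lam β γ).IsChainGibbsMeasure T μ →
      IsShiftInvariant μ →
      μ.map (fun σ : ChainConfig => fun x : ℤ => ((σ x).1, -(σ x).2)) = μ →
    ∀ D : InfiniteChainDynamics (pinnedChain ω₂ lam β γ), D.PreservesMeasure μ →
      (∀ t : ℝ, ∀ᵐ σ ∂μ, D.flow t (shift σ) = shift (D.flow t σ)) →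
      (∀ t : ℝ, D.HasAbsConvergentCorrelation μ t) →
      Continuous (fun t : ℝ => D.currentCorrelation μ t) →
    ∀ ρ : Measure ℝ, IsFiniteMeasure ρ → ρ.map (fun ω : ℝ => -ω) = ρ →
      (∀ t : ℝ, D.currentCorrelation μ t = ∫ ω, Real.cos (ω * t) ∂ρ) →
    ∃ ε Δ c : ℝ, 0 < ε ∧ 0 ≤ Δ ∧ 0 ≤ c ∧
      ∃ f : ℝ → ℝ, Measurable f ∧ (∀ ω : ℝ, 0 ≤ f ω) ∧
        IntegrableOn (fun ω : ℝ => |f ω - c| / ω ^ 2) (Set.Ioo (-ε) ε) ∧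
        ρ.restrict (Set.Ioo (-ε) ε) =
          ENNReal.ofReal Δ • Measure.dirac (0:ℝ) +
            (volume.restrict (Set.Ioo (-ε) ε)).withDensity (fun ω : ℝ => ENNReal.ofReal (f ω)) := by
  sorry

/-! ### By-name statements of the registered stubs -/

namespace Registered

/-- Statement of registered stub S1 (`stub_spectralMeasure`), by name. -/
def stub_spectralMeasure : Prop := type_of% SpectralGerm.stub_spectralMeasure

/-- Statement of registered stub S2 (`stub_germBoundSuperadditive`), by name. -/
def stub_germBoundSuperadditive : Prop := type_of% SpectralGerm.stub_germBoundSuperadditive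

/-- Statement of registered stub S3 (`stub_dcGerm`), by name. -/
def stub_dcGerm : Prop := type_of% SpectralGerm.stub_dcGerm

end Registered

/-- **Skeleton theorem (kernel-checked, no `sorry`): the three stubs give the crux
`CageBudgetFekete.QuasiSuperadditiveHeatVariance` BY NAME.** [folklore] -/
theorem QuasiSuperadditiveHeatVariance_of (hS1 : Registered.stub_spectralMeasure)
    (hS2 : Registered.stub_germBoundSuperadditive) (hS3 : Registered.stub_dcGerm) :
    _root_.Summit.AtomisticToContinuum.FouriersLaw.Theses.CageBudgetFekete.QuasiSuperadditiveHeatVariance := by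
  intro ω₂ lam β γ hω hl hβ T hT μ hG hSI hRefl D hP hShift hAC hC V hV
  obtain ⟨ρ, hρfin, hρsymm, hρ⟩ := hS1 ω₂ lam β γ hω hl hβ T hT μ hG hSI hRefl D hP hShift hAC hC
  obtain ⟨ε, Δ, c, hε, hΔ, hc, f, hfm, hf0, hDini, hgerm⟩ :=
    hS3 ω₂ lam β γ hω hl hβ T hT μ hG hSI hRefl D hP hShift hAC hC ρ hρfin hρsymm hρ
  exact hS2 ρ hρfin (fun t => D.currentCorrelation μ t) hρ V hV ε Δ c hε hΔ hc f hfm hf0 hDini hgerm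

/-- The registered stubs instantiate the skeleton theorem: the crux BY NAME, its only `sorry`s being those of the
three `stub_*`. [folklore] -/
theorem QuasiSuperadditiveHeatVariance_of_stubs :
    _root_.Summit.AtomisticToContinuum.FouriersLaw.Theses.CageBudgetFekete.QuasiSuperadditiveHeatVariance :=
  QuasiSuperadditiveHeatVariance_of stub_spectralMeasure stub_germBoundSuperadditive stub_dcGerm

end Summit.AtomisticToContinuum.FouriersLaw.Cruxes.QuasiSuperadditiveHeatVariance.SpectralGerm
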